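import Summits.AtomisticToContinuum.Crystallization.Theorems.FreeSplittingCertificatesStrictSplittingRuleDefs
import Summits.AtomisticToContinuum.Crystallization.Theorems.ExcessDecayLiouvilleCoarseGrainsHcpEnergySeries
import Summits.AtomisticToContinuum.Crystallization.Theorems.PalmUnimodularRigidityLayeredLawsSelectHcpMinimiserEnclosure
import Summits.AtomisticToContinuum.Crystallization.Theorems.PalmUnimodularRigidityLayeredLawsSelectHcpUniqueMinimiser

/-!
# `StrictSplittingRule` (stmt-AtomisticToContinuum-12560), line `birth`: stub `stub_hcpFamilyMinLocalised` (S0b)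

**What is proved.** `stub_hcpFamilyMinLocalised`: every global minimiser `(a, h)` (`a, h > 0`) of the
Lennard-Jones energy per particle over the two-parameter hcp family `hcp(a', h')` (`HcpFamilyMin a h` of
the line's Defs file) has its layer ratio within 1 % of the ideal one: `|h/(a√(2/3)) − 1| ≤ 1/100`.

**Proof (assembly of landed results, no new numerics).**
* The energy per particle of `hcpPeriodicConfiguration ha hh` is the total energy function `hcpE a h` of
  the `LayeredLawsSelectHcp` line (third clause of the landed series theorem `hcpEnergySeries_of_eq`,
  whose right-hand side is `hcpE a h` by `rfl`), so `HcpFamilyMin a h` says that `(a, h)` is a global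
  minimiser of `hcpE` over the open quadrant.
* The landed relaxed reference `stub_relaxedReference` provides a global minimiser `(a₀, h₀)` in the window
  `[0.945, 0.995] × [0.77, 0.815]`; the two minimal values coincide, so the landed uniqueness theorem
  `tube_hcpE_unique_minimiser` (certified unique maximiser of the shape function `S₃²/S₆`) gives
  `(a, h) = (a₀, h₀)`, and the landed enclosure `tube_minimiserEnclosure` (Fermat-sign bracket of the layer
  ratio) gives `|a − 0.97129| ≤ 10⁻⁴`, `|h − 0.79294| ≤ 10⁻⁴`.
* Hence `c = h/a ∈ [0.80834, 0.82466]` (in fact `|c − 0.81638| ≤ 3·10⁻⁴`), and `0.80834 ≥ 0.99·√(2/3)`,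
  `0.82466 ≤ 1.01·√(2/3)` (`abs_ratio_le_of_mem`).

Numerically the minimiser is `a* ≈ 0.97129`, `c* = h*/a* ≈ 0.81638 = (1 − 1.4·10⁻⁴)·√(2/3)` (Stillinger 2001;
item evidence `lattice_check.out`; an independent interval certificate for the 1 % window designed in this line —
`cert.py`/`cert.json`, compute job j024173 — is kept in the worker folder).  All statements [folklore].
-/

noncomputable section

namespace Summit.AtomisticToContinuum.Crystallization.Theorems.StrictSplittingRuleBirth

open scoped BigOperators Classical
open Literature.MathematicalPhysics.StatisticalMechanics
open Summit.AtomisticToContinuum.Crystallization.Theorems.PalmUnimodularRigidity.LayeredLawsSelectHcp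
  (hcpE hcpQ stub_relaxedReference tube_hcpE_unique_minimiser tube_minimiserEnclosure)
open Summit.AtomisticToContinuum.Crystallization.Theorems.ExcessDecayLiouvilleCoarseGrains
  (hcpEnergySeries_of_eq)

/-- `hcpE a h = e(hcp a h)` for `a, h ≠ 0`: third clause of the landed series theorem
`hcpEnergySeries_of_eq` (its right-hand side is `hcpE a h` by `rfl`, `hcpQ` being the form `Q`). [folklore] -/
private theorem hcpE_eq_energyPerParticle {a h : ℝ} (ha : a ≠ 0) (hh : h ≠ 0) :
    hcpE a h = (hcpPeriodicConfiguration ha hh).energyPerParticle lennardJones :=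
  ((hcpEnergySeries_of_eq a h ha hh hcpQ rfl).2.2).symm

/-- A global minimiser of the hcp-family energy per particle is THE global minimiser of `hcpE`:
`|a − 0.97129| ≤ 10⁻⁴` and `|h − 0.79294| ≤ 10⁻⁴` (landed existence in the window, uniqueness, enclosure).
[folklore] -/
theorem hcpFamilyMin_enclosure {a h : ℝ} (ha : 0 < a) (hh : 0 < h) (hfam : HcpFamilyMin a h) :
    |a - 97129 / 100000| ≤ 1 / 10000 ∧ |h - 79294 / 100000| ≤ 1 / 10000 := by
  obtain ⟨ha', hh', hmin⟩ := hfam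
  have hminE : ∀ a' h' : ℝ, 0 < a' → 0 < h' → hcpE a h ≤ hcpE a' h' := by
    intro a' h' ha'0 hh'0
    rw [hcpE_eq_energyPerParticle ha.ne' hh.ne', hcpE_eq_energyPerParticle ha'0.ne' hh'0.ne']
    exact hmin a' h' ha'0.ne' hh'0.ne' ha'0 hh'0
  obtain ⟨a₀, h₀, ha₁, ha₂, hh₁, hh₂, hmin₀⟩ := stub_relaxedReference
  have ha₀ : 0 < a₀ := by linarith
  have hh₀ : 0 < h₀ := by linarith
  have heq : hcpE a h = hcpE a₀ h₀ := le_antisymm (hminE a₀ h₀ ha₀ hh₀) (hmin₀ a h ha hh)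
  obtain ⟨rfl, rfl⟩ := tube_hcpE_unique_minimiser a₀ h₀ a h ha₀ hh₀ ha hh hmin₀ heq
  exact tube_minimiserEnclosure a h ha₁ ha₂ hh₁ hh₂ hmin₀

/-- Interval arithmetic for the final conversion: `80834/100000 ≤ c ≤ 82466/100000` gives
`|c/√(2/3) − 1| ≤ 1/100` (`0.816496 ≤ √(2/3) ≤ 0.8165`). [folklore] -/
theorem abs_ratio_le_of_mem {c : ℝ} (h₁ : (80834 : ℝ) / 100000 ≤ c) (h₂ : c ≤ (82466 : ℝ) / 100000) :
    |c / Real.sqrt (2 / 3) - 1| ≤ 1 / 100 := by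
  have hs : Real.sqrt (2 / 3) ^ 2 = 2 / 3 := Real.sq_sqrt (by norm_num)
  have hs0 : 0 < Real.sqrt (2 / 3) := Real.sqrt_pos.2 (by norm_num)
  have hs_lo : (816496 : ℝ) / 1000000 ≤ Real.sqrt (2 / 3) := by nlinarith
  have hs_hi : Real.sqrt (2 / 3) ≤ (8165 : ℝ) / 10000 := by nlinarith
  rw [abs_sub_le_iff]
  constructor
  · rw [sub_le_iff_le_add, div_le_iff₀ hs0]
    nlinarith
  · rw [sub_le_comm, le_div_iff₀ hs0]
    nlinarith

/-- **S0b (`stub_hcpFamilyMinLocalised`)**: every global minimiser of the hcp-family Lennard-Jones energy per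
particle has c-axis stretch within 1 %: `|h/(a√(2/3)) − 1| ≤ 1/100`.  The minimiser is the landed unique one,
enclosed in `|a − 0.97129| ≤ 10⁻⁴`, `|h − 0.79294| ≤ 10⁻⁴`, so `h/a ∈ [0.80834, 0.82466]`. [folklore] -/
theorem stub_hcpFamilyMinLocalised : ∀ a h : ℝ, 0 < a → 0 < h → HcpFamilyMin a h →
    |h / (a * Real.sqrt (2 / 3)) - 1| ≤ 1 / 100 := by
  intro a h ha hh hfam
  obtain ⟨hA, hH⟩ := hcpFamilyMin_enclosure ha hh hfam
  rw [abs_sub_le_iff] at hA hH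
  obtain ⟨hA₁, hA₂⟩ := hA
  obtain ⟨hH₁, hH₂⟩ := hH
  rw [show h / (a * Real.sqrt (2 / 3)) = h / a / Real.sqrt (2 / 3) by rw [div_div]]
  refine abs_ratio_le_of_mem ?_ ?_
  · rw [le_div_iff₀ ha]
    nlinarith
  · rw [div_le_iff₀ ha]
    nlinarith

end Summit.AtomisticToContinuum.Crystallization.Theorems.StrictSplittingRuleBirth

end
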